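import Mathlib
import HarnessLib
import Summits.Ventures.LatticeQCDFlow.Scoring.AllPairsAcceptanceVariance

/-!
# LatticeQCDFlow / Scaling — the JENSEN FLOOR of the acceptance on a GENERAL space:
# `acc ≥ exp(E_q[log w] − ½·E_{q⊗q}|log w − log w′|) ≥ exp(E_q[log w] − √(Var_q(log w)/2))`

HONEST FRAMING: exact (Metropolis-corrected) sampling algorithms for lattice gauge theory;
figures of merit are autocorrelation/cost numbers at stated couplings and volumes; no
continuum-physics claim.

Venture `LatticeQCDFlow` (cell pub-lqcd), topic `Scaling`; FANOUT row 3 (`s0-u1-a`, S0-B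
implementation A — deliverable 'training curves', GEN-11).  NEW WORK of the cell (Jensen's
inequality for integrals), the measure-theoretic twin of row 3's finite
`Scaling/AcceptanceJensenFloor` (GEN-11), in the setting of row 3/4's
`Scoring/AllPairsAcceptanceVariance` (imported for the pair-law dictionary): a reference measure
`μ` (s-finite) on any measurable space `X`, a POSITIVE target density `p` (`∫ p dμ = 1`), a
positive model density `q` with law `ν = q dμ` a probability measure, `w = p/q`, `ℓ = log w`, and
the equilibrium acceptance of the exact (independence Metropolis) chain
`acc(p, q) = ∫∫ min(p(a)q(b), p(b)q(a)) dμ dμ = ∫ min(w, w′) d(ν ⊗ ν)`.  NO definition is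
introduced; `E_q[ℓ] = ∫ ℓ dν = −∫ q log(q/p) dμ = −D(q‖p)` is spelled as an integral
(`integral_log_weight_eq_neg`).

* §1 `integral_log_weight_eq_neg` (`E_ν[ℓ] = −D(q‖p)` as integrals);
  `integral_log_pairMin_eq` — `∫ log min(w, w′) d(ν⊗ν) = E_ν[ℓ] − ½∫∫|ℓ − ℓ′| dν dν` for
  `ℓ ∈ L¹(ν)` (`log min(u,v) = (log u + log v)/2 − |log u − log v|/2`, `integral_fun_fst/snd`,
  Fubini);
* §2 **`exp_integral_log_sub_half_mad_le_meanAccept`** — THE JENSEN FLOOR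
  `exp(E_ν[ℓ] − ½·E_{ν⊗ν}|ℓ − ℓ′|) ≤ acc(p, q)` (Mathlib's `ConvexOn.map_integral_le` for `exp` on
  the pair space, `exp ∘ log min(w, w′) = min(w, w′) ∈ L¹(ν ⊗ ν)` with mean `acc`);
* §3 `sq_integral_abs_sub_le_two_mul_var` — for ANY `g ∈ L²(ν)` (ν a probability measure):
  `(∫∫|g − g′| dν dν)² ≤ ∫∫(g − g′)² = 2·(∫ g² dν − (∫ g dν)²)` (Jensen for the square); hence
  **`exp_integral_log_sub_sqrt_half_var_le_meanAccept`** —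
  `acc(p, q) ≥ exp(E_ν[ℓ] − √(Var_ν(ℓ)/2))` for `ℓ ∈ L²(ν)`: the acceptance of the exact chain on
  any configuration space is at least the exponential of minus (reverse-KL training loss + `1/√2`
  standard deviations of the log-weight under the model).

The finite file has the sharper `1/√3` (Glasser) in place of `1/√2`; on a general space the
mid-rank machinery of row 3's `Scaling/MidrankIntegral` would give the same constant and is NOT
redone here.  NOT CLAIMED: any ceiling from these monitors (none exists); anything about `τ_int`;
any acceptance of ours; nothing re-scored.
-/

namespace Summit.Ventures.LatticeQCDFlow.Theory2

open MeasureTheory ProbabilityTheory Set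
open Summit.Ventures.LatticeQCDFlow.Scoring
open Summit.Ventures.LatticeQCDFlow.Scoring.AllPairsVariance

variable {X : Type*} [MeasurableSpace X] {μ : Measure X} [SFinite μ]

/-! ## §1 Dictionary: `E_ν[log w] = −D(q‖p)` and the mean of `log min(w, w′)` -/

omit [SFinite μ] in
/-- **`E_ν[log w] = −∫ q log(q/p) dμ = −D(q‖p)`** for positive densities (`ν = q dμ`). [folklore] -/
theorem integral_log_weight_eq_neg {p q : X → ℝ} (hp0 : ∀ y, 0 < p y) (hq0 : ∀ y, 0 < q y)
    (hqm : Measurable q) :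
    ∫ y, Real.log (p y / q y) ∂(μ.withDensity fun y => ENNReal.ofReal (q y))
      = -∫ y, q y * Real.log (q y / p y) ∂μ := by
  rw [integral_withDensity_eq' (fun y => (hq0 y).le) hqm, ← integral_neg]
  refine integral_congr_ae (Filter.Eventually.of_forall fun y => ?_)
  show Real.log (p y / q y) * q y = -(q y * Real.log (q y / p y))
  rw [Real.log_div (hp0 y).ne' (hq0 y).ne', Real.log_div (hq0 y).ne' (hp0 y).ne']
  ring

omit [MeasurableSpace X] [SFinite μ] in
/-- `log min(u, v) = (log u + log v)/2 − |log u − log v|/2` for the two positive importance ratios.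
[folklore] -/
theorem log_pairMin_eq {p q : X → ℝ} (hp0 : ∀ y, 0 < p y) (hq0 : ∀ y, 0 < q y) (z : X × X) :
    Real.log (min (p z.1 / q z.1) (p z.2 / q z.2))
      = (Real.log (p z.1 / q z.1) + Real.log (p z.2 / q z.2)) / 2
        - |Real.log (p z.1 / q z.1) - Real.log (p z.2 / q z.2)| / 2 := by
  have hu : 0 < p z.1 / q z.1 := div_pos (hp0 _) (hq0 _)
  have hv : 0 < p z.2 / q z.2 := div_pos (hp0 _) (hq0 _)
  rcases le_total (p z.1 / q z.1) (p z.2 / q z.2) with huv | hvu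
  · rw [min_eq_left huv, abs_of_nonpos (sub_nonpos.mpr (Real.log_le_log hu huv))]
    ring
  · rw [min_eq_right hvu, abs_of_nonneg (sub_nonneg.mpr (Real.log_le_log hv hvu))]
    ring

/-- **The mean of `log min(w, w′)` under the pair law**: for `ℓ = log w ∈ L¹(ν)`, `ν` a probability
measure, `∫ log min(w, w′) d(ν ⊗ ν) = ∫ ℓ dν − ½ ∫∫ |ℓ(a) − ℓ(b)| dν dν`. [ours] -/
theorem integral_log_pairMin_eq {p q : X → ℝ} (hp0 : ∀ y, 0 < p y) (hq0 : ∀ y, 0 < q y)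
    [IsProbabilityMeasure (μ.withDensity fun y => ENNReal.ofReal (q y))]
    (hℓ : Integrable (fun y => Real.log (p y / q y)) (μ.withDensity fun y => ENNReal.ofReal (q y))) :
    ∫ z, Real.log (min (p z.1 / q z.1) (p z.2 / q z.2))
        ∂(μ.withDensity fun y => ENNReal.ofReal (q y)).prod
          (μ.withDensity fun y => ENNReal.ofReal (q y))
      = (∫ y, Real.log (p y / q y) ∂(μ.withDensity fun y => ENNReal.ofReal (q y)))
        - (∫ a, ∫ b, |Real.log (p a / q a) - Real.log (p b / q b)|
            ∂(μ.withDensity fun y => ENNReal.ofReal (q y))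
            ∂(μ.withDensity fun y => ENNReal.ofReal (q y))) / 2 := by
  set ν := μ.withDensity fun y => ENNReal.ofReal (q y) with hν
  have h1 : Integrable (fun z : X × X => Real.log (p z.1 / q z.1)) (ν.prod ν) := hℓ.comp_fst ν
  have h2 : Integrable (fun z : X × X => Real.log (p z.2 / q z.2)) (ν.prod ν) := hℓ.comp_snd ν
  have hA : Integrable (fun z : X × X => (Real.log (p z.1 / q z.1) + Real.log (p z.2 / q z.2)) / 2)
      (ν.prod ν) := (h1.add h2).div_const 2
  have hB : Integrable (fun z : X × X => |Real.log (p z.1 / q z.1) - Real.log (p z.2 / q z.2)| / 2)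
      (ν.prod ν) := (h1.sub h2).abs.div_const 2
  have hD : Integrable (fun z : X × X => |Real.log (p z.1 / q z.1) - Real.log (p z.2 / q z.2)|)
      (ν.prod ν) := (h1.sub h2).abs
  have e1 : ∫ z : X × X, Real.log (p z.1 / q z.1) ∂(ν.prod ν) = ∫ y, Real.log (p y / q y) ∂ν := by
    have h := integral_fun_fst (μ := ν) (ν := ν) (fun y => Real.log (p y / q y))
    rw [probReal_univ, one_smul] at h
    exact h
  have e2 : ∫ z : X × X, Real.log (p z.2 / q z.2) ∂(ν.prod ν) = ∫ y, Real.log (p y / q y) ∂ν := by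
    have h := integral_fun_snd (μ := ν) (ν := ν) (fun y => Real.log (p y / q y))
    rw [probReal_univ, one_smul] at h
    exact h
  have e3 : ∫ z : X × X, |Real.log (p z.1 / q z.1) - Real.log (p z.2 / q z.2)| ∂(ν.prod ν)
      = ∫ a, ∫ b, |Real.log (p a / q a) - Real.log (p b / q b)| ∂ν ∂ν := integral_prod _ hD
  simp_rw [log_pairMin_eq hp0 hq0]
  rw [integral_sub hA hB, integral_div, integral_div, integral_add h1 h2, e1, e2, e3]
  ring

/-! ## §2 The Jensen floor -/

/-- **THE JENSEN FLOOR (general space).**  For positive densities `p` (`∫ p dμ = 1`) and `q`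
(`ν = q dμ` a probability measure) with `ℓ = log(p/q) ∈ L¹(ν)`:
`exp(∫ ℓ dν − ½ ∫∫ |ℓ(a) − ℓ(b)| dν dν) ≤ acc(p, q) = ∫∫ min(p(a)q(b), p(b)q(a)) dμ dμ`.
Jensen's inequality for the convex `exp` applied to `log min(w, w′)` under `ν ⊗ ν`, whose
exponential `min(w, w′)` has mean `acc`. [ours] -/
theorem exp_integral_log_sub_half_mad_le_meanAccept {p q : X → ℝ} (hp0 : ∀ y, 0 < p y)
    (hpm : Measurable p) (hpi : Integrable p μ) (hq0 : ∀ y, 0 < q y) (hqm : Measurable q)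
    (hqi : Integrable q μ) [IsProbabilityMeasure (μ.withDensity fun y => ENNReal.ofReal (q y))]
    (hℓ : Integrable (fun y => Real.log (p y / q y)) (μ.withDensity fun y => ENNReal.ofReal (q y))) :
    Real.exp ((∫ y, Real.log (p y / q y) ∂(μ.withDensity fun y => ENNReal.ofReal (q y)))
        - (∫ a, ∫ b, |Real.log (p a / q a) - Real.log (p b / q b)|
            ∂(μ.withDensity fun y => ENNReal.ofReal (q y))
            ∂(μ.withDensity fun y => ENNReal.ofReal (q y))) / 2)
      ≤ ∫ a, ∫ b, min (p a * q b) (p b * q a) ∂μ ∂μ := by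
  set ν := μ.withDensity fun y => ENNReal.ofReal (q y) with hν
  have hw : ∀ y, 0 < p y / q y := fun y => div_pos (hp0 y) (hq0 y)
  have h1 : Integrable (fun z : X × X => Real.log (p z.1 / q z.1)) (ν.prod ν) := hℓ.comp_fst ν
  have h2 : Integrable (fun z : X × X => Real.log (p z.2 / q z.2)) (ν.prod ν) := hℓ.comp_snd ν
  -- integrability of `Y = log min(w, w′)` and of `exp ∘ Y = min(w, w′)`
  have hYi : Integrable (fun z : X × X => Real.log (min (p z.1 / q z.1) (p z.2 / q z.2)))
      (ν.prod ν) := by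
    have e : (fun z : X × X => Real.log (min (p z.1 / q z.1) (p z.2 / q z.2)))
        = fun z => (Real.log (p z.1 / q z.1) + Real.log (p z.2 / q z.2)) / 2
          - |Real.log (p z.1 / q z.1) - Real.log (p z.2 / q z.2)| / 2 :=
      funext fun z => log_pairMin_eq hp0 hq0 z
    rw [e]
    exact ((h1.add h2).div_const 2).sub ((h1.sub h2).abs.div_const 2)
  have hF2 := memLp_pairMin_two (μ := μ) (fun y => (hp0 y).le) hpm hpi hq0 hqm
  have hFi : Integrable (fun z : X × X => min (p z.1 / q z.1) (p z.2 / q z.2)) (ν.prod ν) :=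
    hF2.integrable one_le_two
  have hexp : ∀ z : X × X, Real.exp (Real.log (min (p z.1 / q z.1) (p z.2 / q z.2)))
      = min (p z.1 / q z.1) (p z.2 / q z.2) := fun z => Real.exp_log (lt_min (hw _) (hw _))
  have hgi : Integrable (Real.exp ∘ fun z : X × X => Real.log (min (p z.1 / q z.1) (p z.2 / q z.2)))
      (ν.prod ν) := by
    have e : (Real.exp ∘ fun z : X × X => Real.log (min (p z.1 / q z.1) (p z.2 / q z.2)))
        = fun z => min (p z.1 / q z.1) (p z.2 / q z.2) := funext fun z => hexp z
    rw [e]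
    exact hFi
  -- Jensen
  have hJ := convexOn_exp.map_integral_le (μ := ν.prod ν)
    (f := fun z : X × X => Real.log (min (p z.1 / q z.1) (p z.2 / q z.2)))
    Real.continuous_exp.continuousOn isClosed_univ
    (Filter.Eventually.of_forall fun z => mem_univ _) hYi hgi
  simp_rw [hexp] at hJ
  rw [integral_log_pairMin_eq hp0 hq0 hℓ,
    integral_pairMin_withDensity_eq_meanAccept (fun y => (hp0 y).le) hpm hpi hq0 hqm hqi] at hJ
  exact hJ

/-- The same floor with the loss written against `μ`:
`exp(−∫ q log(q/p) dμ − ½ ∫∫ |ℓ(a) − ℓ(b)| dν dν) ≤ acc(p, q)`. [ours] -/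
theorem exp_neg_kl_sub_half_mad_le_meanAccept {p q : X → ℝ} (hp0 : ∀ y, 0 < p y)
    (hpm : Measurable p) (hpi : Integrable p μ) (hq0 : ∀ y, 0 < q y) (hqm : Measurable q)
    (hqi : Integrable q μ) [IsProbabilityMeasure (μ.withDensity fun y => ENNReal.ofReal (q y))]
    (hℓ : Integrable (fun y => Real.log (p y / q y)) (μ.withDensity fun y => ENNReal.ofReal (q y))) :
    Real.exp (-(∫ y, q y * Real.log (q y / p y) ∂μ)
        - (∫ a, ∫ b, |Real.log (p a / q a) - Real.log (p b / q b)|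
            ∂(μ.withDensity fun y => ENNReal.ofReal (q y))
            ∂(μ.withDensity fun y => ENNReal.ofReal (q y))) / 2)
      ≤ ∫ a, ∫ b, min (p a * q b) (p b * q a) ∂μ ∂μ := by
  rw [← integral_log_weight_eq_neg hp0 hq0 hqm]
  exact exp_integral_log_sub_half_mad_le_meanAccept hp0 hpm hpi hq0 hqm hqi hℓ


/-! ## §3 From the mean difference to the standard deviation -/

omit [SFinite μ] in
/-- **Gini mean difference ≤ `√2` standard deviations, general space**: for a probability measure
`ν` and ANY `g ∈ L²(ν)`, `(∫∫ |g(a) − g(b)| dν dν)² ≤ ∫∫ (g(a) − g(b))² = 2·(∫ g² dν − (∫ g dν)²)`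
(Jensen for the square on `ν ⊗ ν`). [ours] -/
theorem sq_integral_abs_sub_le_two_mul_var {ν : Measure X} [IsProbabilityMeasure ν] {g : X → ℝ}
    (hg : MemLp g 2 ν) :
    (∫ a, ∫ b, |g a - g b| ∂ν ∂ν) ^ 2 ≤ 2 * (∫ y, g y ^ 2 ∂ν - (∫ y, g y ∂ν) ^ 2) := by
  have hgi : Integrable g ν := hg.integrable one_le_two
  have hg2 : Integrable (fun y => g y ^ 2) ν := hg.integrable_sq
  have h1 : Integrable (fun z : X × X => g z.1) (ν.prod ν) := hgi.comp_fst ν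
  have h2 : Integrable (fun z : X × X => g z.2) (ν.prod ν) := hgi.comp_snd ν
  have hD : Integrable (fun z : X × X => |g z.1 - g z.2|) (ν.prod ν) := (h1.sub h2).abs
  have h11 : Integrable (fun z : X × X => g z.1 ^ 2) (ν.prod ν) := hg2.comp_fst ν
  have h22 : Integrable (fun z : X × X => g z.2 ^ 2) (ν.prod ν) := hg2.comp_snd ν
  have h12 : Integrable (fun z : X × X => g z.1 * g z.2) (ν.prod ν) := hgi.mul_prod hgi
  have hS : Integrable (fun z : X × X => g z.1 ^ 2 + g z.2 ^ 2) (ν.prod ν) := h11.add h22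
  have hM : Integrable (fun z : X × X => 2 * (g z.1 * g z.2)) (ν.prod ν) := h12.const_mul 2
  have esq : ∀ z : X × X, |g z.1 - g z.2| ^ 2 = g z.1 ^ 2 + g z.2 ^ 2 - 2 * (g z.1 * g z.2) :=
    fun z => by rw [sq_abs]; ring
  have hD2 : Integrable (fun z : X × X => |g z.1 - g z.2| ^ 2) (ν.prod ν) := by
    simp_rw [esq]
    exact hS.sub hM
  have hgi' : Integrable ((fun x : ℝ => x ^ 2) ∘ fun z : X × X => |g z.1 - g z.2|) (ν.prod ν) := by
    have e : ((fun x : ℝ => x ^ 2) ∘ fun z : X × X => |g z.1 - g z.2|)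
        = fun z => |g z.1 - g z.2| ^ 2 := rfl
    rw [e]
    exact hD2
  -- Jensen for the square
  have hJ := (Even.convexOn_pow (𝕜 := ℝ) even_two).map_integral_le (μ := ν.prod ν)
    (f := fun z : X × X => |g z.1 - g z.2|) (continuous_pow 2).continuousOn isClosed_univ
    (Filter.Eventually.of_forall fun z => mem_univ _) hD hgi'
  have e1 : ∫ z : X × X, g z.1 ^ 2 ∂(ν.prod ν) = ∫ y, g y ^ 2 ∂ν := by
    have h := integral_fun_fst (μ := ν) (ν := ν) (fun y => g y ^ 2)
    rw [probReal_univ, one_smul] at h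
    exact h
  have e2 : ∫ z : X × X, g z.2 ^ 2 ∂(ν.prod ν) = ∫ y, g y ^ 2 ∂ν := by
    have h := integral_fun_snd (μ := ν) (ν := ν) (fun y => g y ^ 2)
    rw [probReal_univ, one_smul] at h
    exact h
  have eD : ∫ z : X × X, |g z.1 - g z.2| ∂(ν.prod ν) = ∫ a, ∫ b, |g a - g b| ∂ν ∂ν :=
    integral_prod _ hD
  have eD2 : ∫ z : X × X, |g z.1 - g z.2| ^ 2 ∂(ν.prod ν)
      = 2 * (∫ y, g y ^ 2 ∂ν - (∫ y, g y ∂ν) ^ 2) := by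
    simp_rw [esq]
    rw [integral_sub hS hM, integral_add h11 h22, integral_const_mul, e1, e2,
      integral_prod_mul (fun a => g a) (fun b => g b)]
    ring
  rw [eD, eD2] at hJ
  exact hJ

/-- **The floor in standard-deviation form (general space)**: for positive densities `p`
(`∫ p dμ = 1`), `q` (`ν = q dμ` a probability measure) and `ℓ = log(p/q) ∈ L²(ν)`:
`exp(∫ ℓ dν − √((∫ ℓ² dν − (∫ ℓ dν)²)/2)) ≤ acc(p, q)` — the acceptance of the exact chain is at
least the exponential of minus (reverse-KL loss + `1/√2` standard deviations of the log-weight).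
[ours] -/
theorem exp_integral_log_sub_sqrt_half_var_le_meanAccept {p q : X → ℝ} (hp0 : ∀ y, 0 < p y)
    (hpm : Measurable p) (hpi : Integrable p μ) (hq0 : ∀ y, 0 < q y) (hqm : Measurable q)
    (hqi : Integrable q μ) [IsProbabilityMeasure (μ.withDensity fun y => ENNReal.ofReal (q y))]
    (hℓ2 : MemLp (fun y => Real.log (p y / q y)) 2 (μ.withDensity fun y => ENNReal.ofReal (q y))) :
    Real.exp ((∫ y, Real.log (p y / q y) ∂(μ.withDensity fun y => ENNReal.ofReal (q y)))
        - Real.sqrt (((∫ y, Real.log (p y / q y) ^ 2 ∂(μ.withDensity fun y => ENNReal.ofReal (q y)))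
            - (∫ y, Real.log (p y / q y) ∂(μ.withDensity fun y => ENNReal.ofReal (q y))) ^ 2) / 2))
      ≤ ∫ a, ∫ b, min (p a * q b) (p b * q a) ∂μ ∂μ := by
  have hℓ : Integrable (fun y => Real.log (p y / q y))
      (μ.withDensity fun y => ENNReal.ofReal (q y)) := hℓ2.integrable one_le_two
  refine le_trans (Real.exp_le_exp.mpr ?_)
    (exp_integral_log_sub_half_mad_le_meanAccept hp0 hpm hpi hq0 hqm hqi hℓ)
  have h := sq_integral_abs_sub_le_two_mul_var hℓ2
  have hle : (∫ a, ∫ b, |Real.log (p a / q a) - Real.log (p b / q b)|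
      ∂(μ.withDensity fun y => ENNReal.ofReal (q y)) ∂(μ.withDensity fun y => ENNReal.ofReal (q y))) / 2
      ≤ Real.sqrt (((∫ y, Real.log (p y / q y) ^ 2 ∂(μ.withDensity fun y => ENNReal.ofReal (q y)))
          - (∫ y, Real.log (p y / q y) ∂(μ.withDensity fun y => ENNReal.ofReal (q y))) ^ 2) / 2) := by
    refine Real.le_sqrt_of_sq_le ?_
    rw [div_pow]
    linarith
  linarith

end Summit.Ventures.LatticeQCDFlow.Theory2
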